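import Summits.AtomisticToContinuum.Crystallization.Theorems.OverbindingBudgetAffineLocalisation

/-!
# OverbindingBudget — the FAR piece Z split along a SMOOTH radial partition: vocabulary, the SHELTER, pieces Z2, Zr‴, Z4″ (Z3‴ and the seam in `…FarSmoothSeam`)
# (decomp-a2c lens-4, generation 48 = v7: critic row 775 «crossing intrinsic faults» — v6's Zr false as typed; on top of v6 = review q15673607 + critic row 762 R1–R6)

Imports ONLY file B (`…OverbindingBudgetAffineLocalisation`) and restates nothing; 0 EQUIV.  The reference structures ARE the Literature's Barlow
stackings `barlowStacking 1 (√(2/3)) s` coded by Hägg sequences `s : ℤ → ℤ` (`IsHaggSeq`, `haggLabel`, `barlowPos`, `alternatingHagg` = hcp;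
`Literature/…/StatisticalMechanics/BarlowStacking.lean`, `HaggStacking.lean`) — no local stacking vocabulary (review q15670697); downstream,
`cuboFrame_barlowPos` (TwoShellIntegerModel) serves Zr‴'s `PatternFar` frames and `barlowPeriodicConfiguration` serves Z2's `e⋆ ≤ refEnergy(hcp chart)`.
Namespace = module name.  WHICH CONE (review q15673607 reason 2): the pieces are PARAMETRIC in `(θ, θ₀, κ)` with `ρ₁ = 12` fixed (the split's support
`8.8·nn` must sit inside the `(ρ₁ − 3)·nn` ball R_aff straightens); the seam's record corollary is stated at `(θ, θ₀, κ) = (1/25, 1/2000, 1/(2·10⁷))`,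
the literals of slot Z of the RDEF cone, consumed through the PARAMETRIC `tbdsg_of_affineLocalisation` — NOT through file B's `…_record` theorems
(`θ₀ = 1/1000`, `κ = 10⁻⁶`, where Z2 is false by the census's own `c_Z·θ₀² ≈ 4–5·10⁻⁷ < κ`).
WHY SMOOTH (DESIGN §0; `zsizing/`): Z's proof cuts each far row `½ Σ_{j∈G} V(r_ij)` into a CORE (vs the site's own strained Barlow structure,
certified `≥ e⋆ + κ + m`) and a TAIL (vs that structure's tail, excess matter charged to walls).  A SHARP cut at `ρ₁·nn` is polytype-sensitive /
continuum-inaccurate at `1.4·10⁻⁶ ≫` the margin; the degree-15 step on `r/nn_i ∈ [9/2, 44/5]` has polytype sensitivity `1.3·10⁻⁸`, continuum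
error `≤ 7·10⁻⁹`.  The tail comparison is an EXCESS-MASS statement (`V < 0` on a normal site's tail support: deficits are free).
v7 — THE SHELTER (critic row 775, scripts `crossfault.py` / `scanwedge.py`).  v6's Zr asked EVERY normal far site for ONE Barlow chart (one stacking
axis) `Cε₁`-exact on its `9·nn` ball.  FALSE: the 18-site two-shell environment of radius `(3/2 + 1/450)·nn` is determined by a site's own close-packed
layer and its two neighbouring layers only (first shell `6+3+3`, second shell at `√2·nn`: `3+3` in the layers `±1`; third distance `≥ √(8/3)·nn >
1.5022·nn`), so every site of a locally close-packed region — including both sides of a single intrinsic fault, Hägg `…cchhcc…` — is `AffReg`, and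
`AffDeepReg 12` is sitewise; hence fcc with intrinsic faults on the NON-PARALLEL planes `(111)`, `(11−1)` crossing along `L ∥ [1−10]` (under a `2·10⁻³`
global strain, so that every good site is far) has good, far, normal-scale sites `13–14.4·nn` from `L` in the acute wedge (nearest doubly-faulted =
non-`AffReg` site `12.04–13.45·nn` away) whose `9·nn` ball straddles BOTH faults: a site across the second fault sits at fractional height `2/3` between the
layers of any single-axis chart, `≥ 0.27·nn` from every structure point ⇒ `IsChart C ε₁` fails once `Cε₁ < 0.27`.  Energetic content nil (`< 10⁻¹⁵ ≪ κ`);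
the defect is in the CUT.  REPAIR (critic R7–R9, in the canonical form R7′): the potential-free predicate `Sheltered R ρ₁ ε₁ θ δ y i` («every site within
`R·nn_i` of `y i` is good») and the SHELTERED NORMAL FAR CLASS `shelteredFarSet R … = (Far ∖ sb).filter (Sheltered R)`; Zr‴ asks charts only of sheltered
sites, at a shelter radius `R` OF THE PROVER'S CHOICE (fixed before `ε₁`); the unsheltered normal far rows are few — `#((Far ∖ sb) ∖ sheltered) ≤
(4R/δ + 1)³·#Gᶜ`, PROVED here by volume packing (good sites are `δ`-separated, `nn ≤ 2` in the window; Literature `card_le_of_separated_of_dist_le`) —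
and the seam floors them crudely (`−1024/(12δ⁶)` per row, `sum_compl_lennardJones_ge`) against `#Gᶜ`.  WHY A SMALL `R` SUFFICES (Zr‴'s geometric
lemma, M): in an all-`AffReg` region the in-layer neighbours of an h-site are h-sites with the SAME axis (the mirror pair of triangles above/below a
common hexagon fragment fits no cuboctahedron and no anticuboctahedron of another axis: azimuth gap `60°` ≫ `3θ + 2ε₁`), so h-layers propagate as whole
planes to the boundary of the region; two non-parallel h-planes meeting the `9·nn` ball cross along a line within `9/sin(α/2) ≈ 15.6·nn` (`α = 70.53°`;
`≤ 18·nn` under the admissible distortion), and a site common to both nets would be h about two axes `70.5°` apart — absurd — unless a non-`AffReg` site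
intervenes within `≈ 1.7·nn` of the line or at a terminating partial; a non-`AffReg` site `k` un-goods every `j` within `12·nn_j` of it, so such a site `i`
has a NON-GOOD site within `≈ 8·nn_i`: `R ≈ 9–18` shelters nothing that cannot be charted.  No shelter literal is baked into any statement.
PIECES (every `C, m, τ, ε, p, R` existential; `e⋆ := ⨅_Q E(Q)`; `G` good, `Far ⊆ G`, `sb := G ∩ scale-bad ⊆ Far`, `Fn := Far ∖ sb`, `Sh_R := Fn ∩
Sheltered R`; `V = r⁻¹²/12 − r⁻⁶/6`):
* Z2 `FarCoreExcess θ θ₀ κ` (CERT · census-fed; text byte-unchanged since v3): admissible charts whose shells are `τ`-matched by a `θ₀`-far frame have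
  `refEnergy ≥ e⋆ + κ + m`.  Census of record (cell rows 752/767/773/775): binding window = fcc-centre / aligned second layers, `c_Z = 0.367`, min far
  excess `9.17·10⁻⁸ = 1.83κ`; `(m, τ) = (2.5·10⁻⁸, 10⁻⁶)`: Stage B (kit j346057, ZCERT23.md ef38880925f71154 on 31280) CERTIFIES the inner zone
  (`t ≤ 2·10⁻³`), Stage D (kit j346084) the ring `2·10⁻³ ≤ t ≤ 2.9516·10⁻²` with interval tables (row 775 (E): certificate of record CONFIRMED);
  beyond: float Stage C, margin `≥ 97×`.  Might fail: an outer pocket (`t > 2.95·10⁻²`) the Stage-C survey grid missed.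
* Zr‴ `ShelteredCoreRegistration θ θ₀` (S/M; replaces v6's `CoreRegistration`): R_aff ⇒ `∀ τ ∃ R C C₂ ε_A ∀ ε₁ ≤ ε_A ∀ δ ∀ N y ∀ i ∈ Sh_R`: an
  admissible `Cε₁`-exact chart (`IsChart`), `PatternFar θ₀ τ`, with `refEnergy − refTail − C₂ε₁ ≤ smoothCore G` (for `R ≥ 9` no bond of the row in the core
  support is omitted at all).  Might fail: the propagation lemma above at the admissible distortion (`θ = 1/25`: azimuth margin `60°` vs `≈ 7°`), or
  the `PatternFar` frame (taken from the site's OWN far `ε₁`-frame, not from R_aff's ball average — memo g46).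
* Z3‴ `ShelteredTailTransferInf/Sel θ θ₀` (L; in the sequel): R_aff ⇒ `∀ C R ∃ C', ε_B ∀ ε₁ ≤ ε_B ∀ δ ∃ C_T ∀ N y F` (charts on `Sh_R` only):
  `Σ_{i∈Sh_R} (tailInf θ (F i) − smoothTail G y i) ≤ C_T·#Gᶜ + C'·ε₁·#Sh_R` — `C_T` after `δ`; `R = 0` is v6's Z3″ verbatim (`Sh_0 = Fn`).
* Z4″ `ScaleBadFloor θ κ` (M + CERT; text byte-unchanged since v6; replaces v5's `ScaleBadPricing θ θ₀ κ`, FALSE as typed — review q15673607, critic row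
  762: the price `1/1000` plus the FULL normal↔sb tail mass `sbMass` (`1.8–2.2·10⁻³` per threshold-Short site inside normal far bulk) exceeds the minimal
  excess of a charge-free threshold-Short affine site (reviewer's strain `E* = (−0.0055, −0.00542, −0.01308, −10⁻⁵, 0.00245, 0.00499)`: nn `0.95644`,
  excess `2.161·10⁻³`; certified affine bracket `c_sb ∈ [1.73, 1.81]·10⁻³`, TAG 187; isotropic compression to the threshold costs `6.77·10⁻³`)):
  R_aff ⇒ `∃ p, ε_C > 0 ∀ ε₁ ≤ ε_C ∀ δ ∃ C₄ ∀ N y`: `#sb·(e⋆ + κ + p) − C₄·#Gᶜ ≤ ½·pairSum sb G` — the scale-bad good class pays ONLY its own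
  floor, `κ` and an EXISTENTIAL price `p` (typing rule (iv); witness of record `p = 1/2000`: margin `c_sb − p − κ = 1.23·10⁻³` absorbs the `O(ε₁)` registration
  error `≈ 5ε₁` for `ε₁ ≤ ε_C ≈ 2·10⁻⁴`; critic row 775 (B): `E_att(0.80) = −0.6998`, `E_att(0.85) = −0.5034`, deficient rows only below nn `≈ 0.795`).
WHO PAYS, PER REGIME (critic R3; unchanged from v6 except (f)): (a) COHERENT scale-bad matter inside normal far bulk (dipped layers; a threshold-Short/Long
grain continuing the normal chart): discrepancy `O(ε₁)` per normal site (layer sums `∝ d⁻⁴`) — Z3‴'s `C'ε₁`; its own rows pay `e⋆ + κ + p` out of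
`c_sb ≥ 1.73·10⁻³` — Z4″.  (b) INCOHERENT denser good grain (spacing `a ∈ [δ, 0.956)`): interface irregular ⇒ walled on both sides (`≥ 17·S/a² + 18·S`
non-good sites); inflicted mass `≤ 3.7·10⁻⁴·S/a³`, `C_T ≍ 2.2·10⁻⁵/a` attained by films (so no `δ`-uniform wall constant exists) — Z3‴'s `C_T(δ)·#Gᶜ`.
(c) WALL-FREE smooth densification (power-law funnels `O(ε₁³)` per site; Möbius funnels `≈ 0.18·δ^{−3/2}` total against `≥ 220Λ²/δ` far-end walls;
exponential cones ratio `10⁻³β³c²ε₁²`): `C'ε₁ + C_T(δ)`.  (d) HYPER-DENSE sb rows (Z4″ omits bonds into `Gᶜ`; `sb = G ∩ (Short ∨ Long)` exactly since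
`G` is `(1/100)`-charge-free): `nn_j ≥ 0.891` all bonds attractive, omission raises the row; `nn_j ∈ [0.80, 0.891)` row `≥ E_att(nn_j) > e⋆ + κ + p`
even with every repulsive bond dropped; `nn_j < 0.80` a deficit needs a `Gᶜ` site within `0.891·nn_j` (omission balls / window-edge sprinkling), each
serving `≤ 22·δ⁻³` rows, deficit `≤ 0.8·δ⁻³`: `C₄(δ) ≲ 18·δ⁻⁶` — legitimate because `C₄` is chosen AFTER `δ`.  (e) isolated irregular sites inflict
nothing (`smoothTail` sums over `G`).  (f) NEW, the lesson of row 775 read in the TAIL: beyond the chart ball a row may see h-planes of a SECOND family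
(its own family is matched by a continuation — `tailInf` is an infimum over continuations); a laterally faulted layer at distance `d ≥ 9·nn` shifts the
row's smooth tail by a Poisson-summation remainder `≲ e^{−(4π/√3)·d/nn} ≤ 10⁻²⁸`, and two families within distance `D` force a crossing/termination
defect within `≈ (D + 9)/sin(α/2)` — a non-good site whose `δ`-discrete shadow pays: part of `C_T(δ)`.  UNSHELTERED normal far rows: crude floor, `#Gᶜ`.
* SEAM: PROVED in the sequel `…FarSmoothSeam` as `Z2 → Zr‴ → Z3‴ → Z4″ → θ ≤ 1/5 → FarAggregatePricing 12 θ θ₀ κ` (`c := p`; `C := C_T + C₄ +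
  (4R/δ + 1)³·(1024/(12δ⁶) + |e⋆ + κ|)`, all obtained after `δ`; `ε₀ := min(ε_A, ε_B, ε_C, m/(C₂ + C' + 1))`).
-/

namespace Summit.AtomisticToContinuum.Crystallization.Theorems.OverbindingBudgetAffineFarSmoothSplit

open scoped BigOperators Classical
open Literature.MathematicalPhysics.StatisticalMechanics
open Literature.Geometry.DiscreteGeometry (nearestDist nearestDist_nonneg nearestDist_le_dist fccTwoShellPattern hcpTwoShellPattern)
open Summit.AtomisticToContinuum.Crystallization.Theorems.OverbindingBudgetBalancedCensusStatements
open Summit.AtomisticToContinuum.Crystallization.Theorems.OverbindingBudgetAffineLadder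
open Summit.AtomisticToContinuum.Crystallization.Theorems.OverbindingBudgetAffineLocalisation

variable {N : ℕ}

local notation "E3" => EuclideanSpace ℝ (Fin 3)

/-- The degree-15 (`C⁷`) smoothstep = regularised incomplete Beta(8,8) in BERNSTEIN form `Σ_{k=8}^{15} C(15,k) tᵏ(1−t)^{15−k}`
(= `6435t⁸ − 40040t⁹ + … − 3432t¹⁵`), clamped: `0` for `t ≤ 0`, `1` for `t ≥ 1`; `σ(1/2) = 1/2`. -/
noncomputable def sigma15 (t : ℝ) : ℝ :=
  if t ≤ 0 then 0 else if 1 ≤ t then 1 else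
    ∑ k ∈ Finset.Icc 8 15, (Nat.choose 15 k : ℝ) * t ^ k * (1 - t) ^ (15 - k)

/-- `0 ≤ σ`. [this file] -/
theorem sigma15_nonneg (t : ℝ) : 0 ≤ sigma15 t := by
  unfold sigma15; split_ifs with h0 h1
  · exact le_rfl
  · exact zero_le_one
  · have h0' : 0 < t := not_le.mp h0
    have h1' : 0 < 1 - t := sub_pos.mpr (not_le.mp h1)
    exact Finset.sum_nonneg fun k _ => by positivity

/-- `σ ≤ 1` (the full Bernstein sum is `(t + (1 − t))¹⁵ = 1`). [this file] -/
theorem sigma15_le_one (t : ℝ) : sigma15 t ≤ 1 := by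
  unfold sigma15; split_ifs with h0 h1
  · exact zero_le_one
  · exact le_rfl
  · have h0' : 0 < t := not_le.mp h0
    have h1' : 0 < 1 - t := sub_pos.mpr (not_le.mp h1)
    have hfull : ∑ k ∈ Finset.range (15 + 1), (Nat.choose 15 k : ℝ) * t ^ k * (1 - t) ^ (15 - k) = 1 :=
      calc ∑ k ∈ Finset.range (15 + 1), (Nat.choose 15 k : ℝ) * t ^ k * (1 - t) ^ (15 - k)
          = ∑ k ∈ Finset.range (15 + 1), t ^ k * (1 - t) ^ (15 - k) * (Nat.choose 15 k : ℝ) :=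
            Finset.sum_congr rfl fun k _ => by ring
        _ = (t + (1 - t)) ^ 15 := (add_pow t (1 - t) 15).symm
        _ = 1 := by ring
    refine le_trans (Finset.sum_le_sum_of_subset_of_nonneg (fun k hk => ?_) fun k _ _ => by positivity) hfull.le
    rw [Finset.mem_Icc] at hk; rw [Finset.mem_range]; omega

/-- Tail weight of a bond of length `r` seen from a site of nearest distance `nn`: `σ((r/nn − 9/2)/(43/10))` — `0` for `r ≤ 4.5·nn`, `1` for
`r ≥ 8.8·nn`. -/
noncomputable def tailW (nn r : ℝ) : ℝ := sigma15 ((r / nn - 9 / 2) / (43 / 10))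

/-- `0 ≤ tailW ≤ 1`. [this file] -/ theorem tailW_nonneg (nn r : ℝ) : 0 ≤ tailW nn r := sigma15_nonneg _
/-- `tailW ≤ 1`. [this file] -/ theorem tailW_le_one (nn r : ℝ) : tailW nn r ≤ 1 := sigma15_le_one _

/-- Smooth CORE of site `i`'s half-row into the class `S`: `½ Σ_{j∈S} (1 − tailW) · V`. -/
noncomputable def smoothCore (S : Finset (Fin N)) (y : Fin N → E3) (i : Fin N) : ℝ :=
  1 / 2 * ∑ j ∈ S, (1 - tailW (nearestDist y i) (dist (y i) (y j))) * lennardJones (dist (y i) (y j))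

/-- Smooth TAIL of site `i`'s half-row into the class `S`: `½ Σ_{j∈S} tailW · V`. -/
noncomputable def smoothTail (S : Finset (Fin N)) (y : Fin N → E3) (i : Fin N) : ℝ :=
  1 / 2 * ∑ j ∈ S, tailW (nearestDist y i) (dist (y i) (y j)) * lennardJones (dist (y i) (y j))

/-- Core + tail = the half-row (partition of unity). [this file] -/
theorem smoothCore_add_smoothTail (S : Finset (Fin N)) (y : Fin N → E3) (i : Fin N) :
    smoothCore S y i + smoothTail S y i = 1 / 2 * ∑ j ∈ S, lennardJones (dist (y i) (y j)) := by
  unfold smoothCore smoothTail; rw [← mul_add, ← Finset.sum_add_distrib]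
  exact congrArg _ (Finset.sum_congr rfl fun j _ => by ring)

/-- Summing the half-rows of a class `S` into `T` gives `½·pairSum S T`. [this file] -/
theorem sum_smoothCore_add_smoothTail (S T : Finset (Fin N)) (y : Fin N → E3) :
    ∑ i ∈ S, (smoothCore T y i + smoothTail T y i) = 1 / 2 * pairSum S T y := by
  simp_rw [smoothCore_add_smoothTail]; unfold pairSum; rw [Finset.mul_sum]

/-- The reference two shells of the Barlow stacking coded by the Hägg sequence `s` (Literature `barlowStacking 1 √(2/3) s`: in-layer
spacing `1`, ideal layer spacing `√(2/3)`, layer `0` through the origin) at the centre: nonzero structure points of norm `≤ 3/2` (norms `1`, `√2`). -/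
def twoShellRef (s : ℤ → ℤ) : Set E3 := {p | p ∈ barlowStacking 1 (Real.sqrt (2 / 3)) s ∧ p ≠ 0 ∧ ‖p‖ ≤ 3 / 2}

/-- A CHART: a Hägg sequence (coding the reference Barlow stacking `barlowStacking 1 √(2/3) s` of the Literature), a linear part, a scale, and
the reference nearest distance `nn = a₀ · min_{p ≠ 0} ‖B p‖`. -/
structure Chart where
  /-- the Hägg sequence of the reference Barlow stacking (`IsHaggSeq` for admissible charts) -/
  s : ℤ → ℤ
  /-- the linear part (close to a linear isometry) -/
  B : E3 →ₗ[ℝ] E3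
  /-- the scale -/
  a₀ : ℝ
  /-- the reference nearest distance -/
  nn : ℝ

/-- Reference SITE ENERGY of a chart: `½ Σ'_{p ∈ structure} V(a₀‖B p‖)` (the centre term is `V(0) = 0`). -/
noncomputable def refEnergy (c : Chart) : ℝ :=
  1 / 2 * ∑' p : ↥(barlowStacking 1 (Real.sqrt (2 / 3)) c.s), lennardJones (c.a₀ * ‖c.B (p : E3)‖)

/-- Reference smooth TAIL of a chart: `½ Σ'_{p} tailW(nn, a₀‖B p‖) · V(a₀‖B p‖)`. -/
noncomputable def refTail (c : Chart) : ℝ :=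
  1 / 2 * ∑' p : ↥(barlowStacking 1 (Real.sqrt (2 / 3)) c.s), tailW c.nn (c.a₀ * ‖c.B (p : E3)‖) * lennardJones (c.a₀ * ‖c.B (p : E3)‖)

/-- ADMISSIBLE chart at distortion `θ`: a genuine Hägg sequence (`IsHaggSeq`: steps `±1`, so consecutive layers differ), positive scale, `B` within `3θ`
of a linear isometry in operator sense, `nn` is the reference nearest distance, and the reference site-energy series is SUMMABLE (part of admissibility, so no
`tsum` below is junk; Zr owes it when it produces charts: `r⁻⁶` tail on a uniformly discrete set — S). -/
def ChartAdmissible (θ : ℝ) (c : Chart) : Prop :=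
  IsHaggSeq c.s ∧ 0 < c.a₀ ∧ 0 < c.nn ∧ (∃ Q : E3 →ₗᵢ[ℝ] E3, ∀ v : E3, ‖c.B v - Q v‖ ≤ 3 * θ * ‖v‖) ∧
    (∀ p ∈ barlowStacking 1 (Real.sqrt (2 / 3)) c.s, p ≠ 0 → c.nn ≤ c.a₀ * ‖c.B p‖) ∧
    (∃ p ∈ barlowStacking 1 (Real.sqrt (2 / 3)) c.s, p ≠ 0 ∧ c.nn = c.a₀ * ‖c.B p‖) ∧
    Summable fun p : ↥(barlowStacking 1 (Real.sqrt (2 / 3)) c.s) => lennardJones (c.a₀ * ‖c.B (p : E3)‖)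

/-- The reference TAIL series of an admissible chart is summable too (weights in `[0,1]`). [this file] -/
theorem summable_refTail {θ : ℝ} {c : Chart} (h : ChartAdmissible θ c) :
    Summable fun p : ↥(barlowStacking 1 (Real.sqrt (2 / 3)) c.s) =>
      tailW c.nn (c.a₀ * ‖c.B (p : E3)‖) * lennardJones (c.a₀ * ‖c.B (p : E3)‖) :=
  Summable.of_norm_bounded h.2.2.2.2.2.2.abs fun p => by
    rw [Real.norm_eq_abs, abs_mul]
    exact mul_le_of_le_one_left (abs_nonneg _) (abs_le.mpr ⟨by linarith [tailW_nonneg c.nn (c.a₀ * ‖c.B (p : E3)‖)], tailW_le_one _ _⟩)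

/-- `PatternFar θ₀ s c`: the chart's `nn`-normalised two shells are `s`-matched, injectively, by an AFFINE FRAME `A₀` of the fcc or the hcp
two-shell pattern that is `θ₀`-FAR from every linear isometry on the pattern (the frame a far site's registration provides). -/
def PatternFar (θ₀ s : ℝ) (c : Chart) : Prop :=
  ∃ (A₀ : E3 →ₗ[ℝ] E3) (P : Finset E3) (π : E3 → E3),
    (P = fccTwoShellPattern ∨ P = hcpTwoShellPattern) ∧
    (∀ v ∈ P, π v ∈ twoShellRef c.s ∧ ‖(c.a₀ / c.nn) • c.B (π v) - A₀ v‖ ≤ s) ∧ Set.InjOn π ↑P ∧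
    ∀ Q : E3 →ₗᵢ[ℝ] E3, ∃ v ∈ P, θ₀ < ‖A₀ v - Q v‖

/-- `IsChart C ε₁ y i c`: the chart is `C ε₁`-EXACT for the configuration `y` at site `i` on the ball of radius `9 · nearestDist y i`:
its `nn` is the actual nearest distance up to `C ε₁`, every site in the ball is `C ε₁ nn`-near a structure point, and every structure point
predicted inside the ball is `C ε₁ nn`-near a site.  (R_aff's conclusion at `ρ = 12`, read through a Barlow stacking.) -/
def IsChart (C ε₁ : ℝ) (y : Fin N → E3) (i : Fin N) (c : Chart) : Prop :=
  |c.nn - nearestDist y i| ≤ C * ε₁ * nearestDist y i ∧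
  (∀ k : Fin N, dist (y k) (y i) ≤ 9 * nearestDist y i →
    ∃ p ∈ barlowStacking 1 (Real.sqrt (2 / 3)) c.s, dist (y k) (y i + c.a₀ • c.B p) ≤ C * ε₁ * nearestDist y i) ∧
  (∀ p ∈ barlowStacking 1 (Real.sqrt (2 / 3)) c.s, c.a₀ * ‖c.B p‖ ≤ 9 * nearestDist y i →
    ∃ k : Fin N, dist (y k) (y i + c.a₀ • c.B p) ≤ C * ε₁ * nearestDist y i)

/-! ## The shelter (v7): sheltered sites, the sheltered normal far class, and the PROVED packing count of the unsheltered rows -/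

/-- `Sheltered R ρ₁ ε₁ θ δ y i`: every site within `R · nearestDist y i` of `y i` is GOOD (potential-free, chart-free; `R ≤ 0` shelters trivially for
an injective configuration's good site). -/
def Sheltered (R ρ₁ ε₁ θ δ : ℝ) (y : Fin N → E3) (i : Fin N) : Prop :=
  ∀ k : Fin N, dist (y k) (y i) ≤ R * nearestDist y i → k ∈ goodSet ρ₁ ε₁ θ δ y

/-- **The SHELTERED NORMAL FAR class at shelter radius `R`**: far, not scale-bad, and `R`-sheltered. -/
noncomputable def shelteredFarSet (R θ₀ ρ₁ ε₁ θ δ : ℝ) (y : Fin N → E3) : Finset (Fin N) :=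
  (farSet θ₀ ρ₁ ε₁ θ δ y \ goodScaleBadSet ρ₁ ε₁ θ δ y).filter fun i => Sheltered R ρ₁ ε₁ θ δ y i

/-- `Sh_R ⊆ Far ∖ sb`. [this file] -/
theorem shelteredFarSet_subset (R θ₀ ρ₁ ε₁ θ δ : ℝ) (y : Fin N → E3) :
    shelteredFarSet R θ₀ ρ₁ ε₁ θ δ y ⊆ farSet θ₀ ρ₁ ε₁ θ δ y \ goodScaleBadSet ρ₁ ε₁ θ δ y :=
  Finset.filter_subset _ _

/-- Membership in `Sh_R`: far, not scale-bad, sheltered. [this file] -/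
theorem mem_shelteredFarSet {R θ₀ ρ₁ ε₁ θ δ : ℝ} {y : Fin N → E3} {i : Fin N} :
    i ∈ shelteredFarSet R θ₀ ρ₁ ε₁ θ δ y ↔
      (i ∈ farSet θ₀ ρ₁ ε₁ θ δ y ∧ i ∉ goodScaleBadSet ρ₁ ε₁ θ δ y) ∧ Sheltered R ρ₁ ε₁ θ δ y i := by
  unfold shelteredFarSet; rw [Finset.mem_filter, Finset.mem_sdiff]

/-- `Far ⊆ G`. [this file] -/
theorem farSet_subset_goodSet (θ₀ ρ₁ ε₁ θ δ : ℝ) (y : Fin N → E3) : farSet θ₀ ρ₁ ε₁ θ δ y ⊆ goodSet ρ₁ ε₁ θ δ y := by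
  unfold farSet; exact Finset.filter_subset _ _

/-- Good sites are in the window: `δ ≤ nn_i ≤ 2`. [this file] -/
theorem inWindow_of_mem_goodSet {ρ₁ ε₁ θ δ : ℝ} {y : Fin N → E3} {i : Fin N} (hi : i ∈ goodSet ρ₁ ε₁ θ δ y) :
    δ ≤ nearestDist y i ∧ nearestDist y i ≤ 2 := by
  unfold goodSet at hi; rw [Finset.mem_filter] at hi; exact hi.2.2

/-- **Volume packing of good sites**: the good sites within distance `ρ ≥ 0` of any point number at most `(2ρ/δ + 1)³` (`δ > 0` the window floor:
good sites are `δ`-separated from everything). [Literature `card_le_of_separated_of_dist_le`; this file] -/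
theorem card_goodSet_filter_dist_le {ρ₁ ε₁ θ δ : ℝ} (hδ : 0 < δ) {y : Fin N → E3} (hy : Function.Injective y) (p : E3) {ρ : ℝ} (hρ : 0 ≤ ρ) :
    (((goodSet ρ₁ ε₁ θ δ y).filter fun i => dist (y i) p ≤ ρ).card : ℝ) ≤ (2 * ρ / δ + 1) ^ 3 := by
  have hTi : (((goodSet ρ₁ ε₁ θ δ y).filter fun i => dist (y i) p ≤ ρ).image y).card
      = ((goodSet ρ₁ ε₁ θ δ y).filter fun i => dist (y i) p ≤ ρ).card := Finset.card_image_of_injective _ hy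
  have h := card_le_of_separated_of_dist_le (((goodSet ρ₁ ε₁ θ δ y).filter fun i => dist (y i) p ≤ ρ).image y) p hδ hρ
    (fun c hc => by obtain ⟨i, hi, rfl⟩ := Finset.mem_image.mp hc; exact (Finset.mem_filter.mp hi).2)
    (fun c hc d hd hcd => by
      obtain ⟨i, hi, rfl⟩ := Finset.mem_image.mp hc
      obtain ⟨j, hj, rfl⟩ := Finset.mem_image.mp hd
      have hij : j ≠ i := fun h => hcd (by rw [h])
      exact (inWindow_of_mem_goodSet (Finset.mem_filter.mp hi).1).1.trans (nearestDist_le_dist y hij))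
  rwa [finrank_euclideanSpace_fin, hTi] at h

/-- **THE PACKING COUNT (PROVED): the unsheltered rows of a good class are few** — `#(S ∖ Sheltered R) ≤ (4R/δ + 1)³·#Gᶜ` for `S ⊆ G`: an unsheltered
good site has a NON-GOOD site within `R·nn_i ≤ 2R`, and each non-good site has at most `(4R/δ + 1)³` good sites within `2R`. [this file] -/
theorem card_filter_not_sheltered_le {R ρ₁ ε₁ θ δ : ℝ} (hR : 0 ≤ R) (hδ : 0 < δ) {y : Fin N → E3} (hy : Function.Injective y)
    {S : Finset (Fin N)} (hS : S ⊆ goodSet ρ₁ ε₁ θ δ y) :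
    ((S.filter fun i => ¬ Sheltered R ρ₁ ε₁ θ δ y i).card : ℝ) ≤ (4 * R / δ + 1) ^ 3 * (((goodSet ρ₁ ε₁ θ δ y)ᶜ).card : ℝ) := by
  have hcover : (S.filter fun i => ¬ Sheltered R ρ₁ ε₁ θ δ y i) ⊆
      (goodSet ρ₁ ε₁ θ δ y)ᶜ.biUnion fun k => (goodSet ρ₁ ε₁ θ δ y).filter fun i => dist (y i) (y k) ≤ 2 * R := by
    intro i hi
    rw [Finset.mem_filter] at hi
    obtain ⟨hiS, hns⟩ := hi
    have hiG : i ∈ goodSet ρ₁ ε₁ θ δ y := hS hiS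
    unfold Sheltered at hns
    obtain ⟨k, hk'⟩ := not_forall.mp hns
    obtain ⟨hk, hkG⟩ := Classical.not_imp.mp hk'
    rw [Finset.mem_biUnion]
    refine ⟨k, Finset.mem_compl.mpr hkG, Finset.mem_filter.mpr ⟨hiG, ?_⟩⟩
    have hnn2 : nearestDist y i ≤ 2 := (inWindow_of_mem_goodSet hiG).2
    rw [dist_comm]
    exact hk.trans (by nlinarith)
  calc ((S.filter fun i => ¬ Sheltered R ρ₁ ε₁ θ δ y i).card : ℝ)
      ≤ (((goodSet ρ₁ ε₁ θ δ y)ᶜ.biUnion fun k => (goodSet ρ₁ ε₁ θ δ y).filter fun i => dist (y i) (y k) ≤ 2 * R).card : ℝ) := by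
        exact_mod_cast Finset.card_le_card hcover
    _ ≤ ∑ k ∈ (goodSet ρ₁ ε₁ θ δ y)ᶜ, ((((goodSet ρ₁ ε₁ θ δ y).filter fun i => dist (y i) (y k) ≤ 2 * R).card : ℕ) : ℝ) := by
        exact_mod_cast Finset.card_biUnion_le
    _ ≤ ∑ k ∈ (goodSet ρ₁ ε₁ θ δ y)ᶜ, (4 * R / δ + 1) ^ 3 := Finset.sum_le_sum fun k _ => by
        have h := card_goodSet_filter_dist_le (ρ₁ := ρ₁) (ε₁ := ε₁) (θ := θ) hδ hy (y k) (by positivity : (0 : ℝ) ≤ 2 * R)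
        calc ((((goodSet ρ₁ ε₁ θ δ y).filter fun i => dist (y i) (y k) ≤ 2 * R).card : ℕ) : ℝ) ≤ (2 * (2 * R) / δ + 1) ^ 3 := h
          _ = (4 * R / δ + 1) ^ 3 := by ring
    _ = (4 * R / δ + 1) ^ 3 * ((((goodSet ρ₁ ε₁ θ δ y)ᶜ).card : ℕ) : ℝ) := by rw [Finset.sum_const, nsmul_eq_mul, mul_comm]

/-- **The unsheltered normal far rows are few: `#((Far ∖ sb) ∖ Sh_R) ≤ (4R/δ + 1)³·#Gᶜ`** (what the seam uses). [this file] -/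
theorem card_far_not_sheltered_le {R θ₀ ρ₁ ε₁ θ δ : ℝ} (hR : 0 ≤ R) (hδ : 0 < δ) {y : Fin N → E3} (hy : Function.Injective y) :
    (((farSet θ₀ ρ₁ ε₁ θ δ y \ goodScaleBadSet ρ₁ ε₁ θ δ y) \ shelteredFarSet R θ₀ ρ₁ ε₁ θ δ y).card : ℝ)
      ≤ (4 * R / δ + 1) ^ 3 * (((goodSet ρ₁ ε₁ θ δ y)ᶜ).card : ℝ) := by
  have hset : (farSet θ₀ ρ₁ ε₁ θ δ y \ goodScaleBadSet ρ₁ ε₁ θ δ y) \ shelteredFarSet R θ₀ ρ₁ ε₁ θ δ y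
      = (farSet θ₀ ρ₁ ε₁ θ δ y \ goodScaleBadSet ρ₁ ε₁ θ δ y).filter fun i => ¬ Sheltered R ρ₁ ε₁ θ δ y i := by
    unfold shelteredFarSet; rw [Finset.sdiff_eq_filter]; ext i
    simp only [Finset.mem_filter, Finset.mem_sdiff]
    tauto
  rw [hset]
  exact card_filter_not_sheltered_le hR hδ hy
    ((Finset.sdiff_subset).trans (farSet_subset_goodSet θ₀ ρ₁ ε₁ θ δ y))

/-- **Z2 · `FarCoreExcess θ θ₀ κ`** (NEW · TRUE-type · CERT · ATTACKABLE-M; the instrument item, text unchanged since v3): `∃ m τ > 0`, every admissible chart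
whose shells are `τ`-matched by a `θ₀`-far frame has `refEnergy ≥ e⋆ + κ + m`.  [census of record, cell rows 752/767 + Stage B j346057 (ZCERT23.md): binding
window fcc-centre/aligned, `c_Z = 0.367`, min far excess `9.17·10⁻⁸ = 1.83κ`; inner zone CERTIFIED at `(m, τ) = (2.5·10⁻⁸, 10⁻⁶)`; memo SIZING-g46-Z §2] -/
def FarCoreExcess (θ θ₀ κ : ℝ) : Prop :=
  ∃ m τ : ℝ, 0 < m ∧ 0 < τ ∧ ∀ c : Chart, ChartAdmissible θ c → PatternFar θ₀ τ c →
    (⨅ Q : PeriodicConfiguration 3, Q.energyPerParticle lennardJones) + κ + m ≤ refEnergy c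

/-- **Zr‴ · `ShelteredCoreRegistration θ θ₀`** (v7 · NEW · TRUE-type · ATTACKABLE-S/M; replaces v6's `CoreRegistration`, FALSE as typed — critic row 775,
«crossing intrinsic faults»): R_aff ⇒ for every `τ > 0` there are a SHELTER RADIUS `R ≥ 0` and `C, C₂, ε_A` such that for `ε₁ ≤ ε_A`, every window and every
injective configuration, every `R`-SHELTERED normal-scale far site has an admissible, `C ε₁`-exact chart, `PatternFar θ₀ τ`, with `refEnergy − refTail − C₂ ε₁
≤ smoothCore G`.  Content: the single-axis rigidity of sheltered balls (module doc «WHY A SMALL `R` SUFFICES»; `R ≈ 9–18` expected), the Hägg coding of the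
stacking read off R_aff's straightened ball (any finite close-packed layer word continues to an `IsHaggSeq`), the frame `PatternFar` from the site's own far
`ε₁`-frame, summability (`…BarlowSum`), and the core comparison (`IsChart` moves each core bond by `≤ Cε₁·nn`; for `R ≥ 9` nothing in the core is omitted).
Might fail: the in-layer propagation of the h-axis at distortion `3θ = 0.12` (margin: azimuth `60°`), i.e. only by a second rigidity surprise of the row-775 kind
— now confined to ONE radius-`R` ball with every site good. -/
def ShelteredCoreRegistration (θ θ₀ : ℝ) : Prop :=
  AffineChartStraightening → ∀ τ : ℝ, 0 < τ →
    ∃ R C C₂ εA : ℝ, 0 ≤ R ∧ 0 ≤ C ∧ 0 ≤ C₂ ∧ 0 < εA ∧ ∀ ε₁ : ℝ, 0 < ε₁ → ε₁ ≤ εA → ∀ δ : ℝ, 0 < δ → δ ≤ 2 →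
      ∀ (N : ℕ) (y : Fin N → E3), Function.Injective y →
        ∀ i ∈ shelteredFarSet R θ₀ 12 ε₁ θ δ y,
          ∃ c : Chart, IsChart C ε₁ y i c ∧ ChartAdmissible θ c ∧ PatternFar θ₀ τ c ∧
            refEnergy c - refTail c - C₂ * ε₁ ≤ smoothCore (goodSet 12 ε₁ θ δ y) y i

/-- **Z4″ · `ScaleBadFloor θ κ`** (NEW in v6 · TRUE-type · ATTACKABLE-M (+CERT `c_sb`); replaces v5's `ScaleBadPricing`, review q15673607): R_aff ⇒ for some
price `p > 0` and `ε_C > 0`, all `ε₁ ≤ ε_C`, all windows `[δ, 2]`, some `C₄ ≥ 0` chosen AFTER `δ`, every injective configuration: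
`#sb·(e⋆ + κ + p) − C₄·#Gᶜ ≤ ½·pairSum sb G` — the scale-bad good class pays its floor, `κ` and `p` out of its OWN per-site excess (`c_sb ≥ 1.73·10⁻³`
at the thresholds, witness `p = 1/2000`); no tail mass of the normal class is charged to it.  Walls / `O(ε₁)` drift / hyper-dense rows: module doc (b)–(d).
Might fail: only through the wall bookkeeping of regimes (b)/(d) — a deficient row (possible for `nn_j < 0.80`) always has a `Gᶜ` site within `0.891`
or walled foreign matter beyond `12·nn_j`, and the crude rate `C₄(δ) ≲ 18·δ⁻⁶` is unproved; the threshold minimum itself is `c_sb ≥ 1.73·10⁻³ ≫ κ + p`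
(census ask I-SB(a) certifies `c_sb`). -/
def ScaleBadFloor (θ κ : ℝ) : Prop :=
  AffineChartStraightening →
    ∃ p εC : ℝ, 0 < p ∧ 0 < εC ∧ ∀ ε₁ : ℝ, 0 < ε₁ → ε₁ ≤ εC → ∀ δ : ℝ, 0 < δ → δ ≤ 2 →
      ∃ C4 : ℝ, 0 ≤ C4 ∧ ∀ (N : ℕ) (y : Fin N → E3), Function.Injective y →
        ((goodScaleBadSet 12 ε₁ θ δ y).card : ℝ) * ((⨅ Q : PeriodicConfiguration 3, Q.energyPerParticle lennardJones) + κ + p)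
          - C4 * (((goodSet 12 ε₁ θ δ y)ᶜ).card : ℝ)
          ≤ 1 / 2 * pairSum (goodScaleBadSet 12 ε₁ θ δ y) (goodSet 12 ε₁ θ δ y) y

/-- `G ∩ scale-bad ⊆ Far` (both are filters of `G`; a scale-bad site fails the near clause). [this file] -/
theorem goodScaleBadSet_subset_farSet (θ₀ ρ₁ ε₁ θ δ : ℝ) (y : Fin N → E3) :
    goodScaleBadSet ρ₁ ε₁ θ δ y ⊆ farSet θ₀ ρ₁ ε₁ θ δ y := by
  intro i hi; unfold goodScaleBadSet at hi; unfold farSet; rw [Finset.mem_filter] at hi ⊢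
  exact ⟨hi.1, fun h => h.2 hi.2⟩

/-- `pairSum` is additive in its first class over a disjoint union. [this file] -/
theorem pairSum_union_left {S₁ S₂ : Finset (Fin N)} (h : Disjoint S₁ S₂) (T : Finset (Fin N)) (y : Fin N → E3) :
    pairSum (S₁ ∪ S₂) T y = pairSum S₁ T y + pairSum S₂ T y := by
  unfold pairSum; rw [Finset.sum_union h]


end Summit.AtomisticToContinuum.Crystallization.Theorems.OverbindingBudgetAffineFarSmoothSplit
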